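import Summits.HodgeConjecture.HodgeConjecture.Theorems.VHCAbelianSchemesRoadMoverFamilyOfConfined
import Summits.HodgeConjecture.HodgeConjecture.Theorems.VHCAbelianSchemesRoadTwistConfinedMoverFamilyDefs
import HarnessLib

/-!
# Road №4 (`VHCAbelianSchemesRoad`) — (MM) BY NAME: `MoverFamilyOfConfined` HOLDS, and the lens line T's compositions with (MM) discharged

research route conditional on HC_CM; not a corollary; Q11.4-sentence-2 already refuted in dim ≥ 3.

PROOFS ONLY (core-w5 gen 3, width copy of seat core-D; helper `--supports stmt-HodgeConjecture-26512`; `HC_CM` nowhere; ZERO new named facts;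
nothing about any cell, stub of `birth.lean`, crux, carrier, `HC_AV` or HC is asserted). The kernel-class stub (MM) `stub_moverFamily_of_confined`
of the lens line T (`Cruxes/DiagLocalOfMarkmanPinnedForall/TwistConfinedMoverFamily.lean` §2; crux stmt-HodgeConjecture-26512, research stub (c4a)
re-cut as (MM) ∧ (inj) ∧ (c4a-T)) was proved with its predicates unfolded in `VHCAbelianSchemesRoadMoverFamilyOfConfined`
(`SecantQuotientDatum.exists_bad_offDiagonalExtVanishing_of_isMover`, p664678); the predicates `MoverKernelJumpConfined`, `InjOnMoverKernels`,
`TorsionSparse` and the statement-Prop `MoverFamilyOfConfined` now live under `Theorems/` (`VHCAbelianSchemesRoadTwistConfinedMoverFamilyDefs`,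
p664289, token-verbatim the Cruxes bodies). This file states (MM) BY NAME — `moverFamily_of_confined` is the stub's signature VERBATIM,
`moverFamilyOfConfined_holds : MoverFamilyOfConfined` — both by `δ`-unfolding of the three predicates (no new mathematics), and records the
line's two sorry-free compositions with (MM) DISCHARGED: (c4a) `PrintSheafHandleExists C` from the fallback residue (c4a-T♭) alone, and from
(inj) ∧ the pinned residue (c4a-T). The residues are RESEARCH (print's object wall) and (inj) is core-w3 g2's plate: they stay HYPOTHESES here.

Nothing here says (inj), (c4a-T), (c4a-T♭), (c4a), any stub of `birth.lean`, 26512, 26511, №4, `HC_AV`, `HC_CM` or HC holds; HC_CM HELD, by name only.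

References: [cite: Markman2025SecantWeil, §9.3 Lemma 9.3.3 and Thm. 1.4.1] [cite: MumfordAV1970, §7 Thm. 4 (p. 72)] [cite: Mukai1978, §3]
[cite: Raynaud1983SousVarietes, Théorème principal].
-/

noncomputable section

open CategoryTheory CategoryTheory.Limits AlgebraicGeometry

namespace Summit.HodgeConjecture.HodgeConjecture.Ring2.SemiregularRepresentatives

set_option linter.dupNamespace false -- the cell's namespace repeats the summit name, as in every `Ring2*` file

namespace TwistConfinedMoverFamily

open Literature.AlgebraicGeometry Literature.AlgebraicGeometry.Motives Literature.AlgebraicGeometry.Motives.AbelianVariety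
open Literature.AlgebraicGeometry.HodgeTheory Literature.AlgebraicGeometry.Markman2025

/-- **(MM) — the mover family from jump confinement, BY NAME** (the signature of the lens line T's `stub_moverFamily_of_confined`
VERBATIM over the Theorems-lane predicates): if the off-diagonal jumps of `E•` on the mover kernels are confined through `λ_m`, injective
on `Ker u_m(ℂ)` for good `m`, to a torsion-sparse `B`, then off a finite set of bad moduli `> 1` every mover `ḡ_{u_m}` satisfies
`(C^∨_{u_m})` for `E•`. Proof: `SecantQuotientDatum.exists_bad_offDiagonalExtVanishing_of_isMover` read through the definitions of
`MoverKernelJumpConfined` (with `OffDiagJump`), `InjOnMoverKernels`, `TorsionSparse`. [cite: Markman2025SecantWeil, §9.3 Lemma 9.3.3]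
[cite: MumfordAV1970, §7 Thm. 4 (p. 72)] [cite: Raynaud1983SousVarietes, Théorème principal] -/
theorem moverFamily_of_confined (D : SecantQuotientDatum) (E : CochainComplex D.Y.X.left.Modules ℤ) {A' : AbelianVariety ℂ}
    (lam : ℤ → (D.P ⟶ A')) (B : Set (A'.Points ℂ))
    (hB : MoverKernelJumpConfined D E lam B) (hinj : InjOnMoverKernels D lam) (hT : TorsionSparse B) :
    ∃ bad : Finset ℕ, (∀ N ∈ bad, 1 < N) ∧
      ∀ (m : ℤ) (g : D.Y ⟶ D.Y), D.IsMover m g → (∀ N ∈ bad, ¬ ((N : ℤ) ∣ m ^ 2 + (D.d : ℤ))) →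
        OffDiagonalExtVanishing D.Y g E :=
  D.exists_bad_offDiagonalExtVanishing_of_isMover E lam B hB hinj hT

/-- **`MoverFamilyOfConfined` HOLDS**: the statement-Prop of (MM) is a theorem. [cite: Markman2025SecantWeil, §9.3 Lemma 9.3.3]
[cite: Mukai1978, §3] -/
theorem moverFamilyOfConfined_holds : MoverFamilyOfConfined :=
  fun D E _ lam B hB hinj hT => D.exists_bad_offDiagonalExtVanishing_of_isMover E lam B hB hinj hT

/-- **(c4a) from the FALLBACK residue (c4a-T♭) alone**, (MM) discharged: at every `C`, `PrintCarrierConfinedExists C → PrintSheafHandleExists C`.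
The residue is RESEARCH (print's object: Orlov–Künneth + the factor-2 table) and stays a hypothesis. [cite: Markman2025SecantWeil, Thm. 1.4.1 and §9.3] -/
theorem printSheafHandleExists_of_printCarrierConfinedExists (C : ChernCharacterBetti) (hT : PrintCarrierConfinedExists C) :
    PrintSheafHandleExists C :=
  printSheafHandleExists_of_confinedExists C moverFamilyOfConfined_holds hT

/-- **(c4a) from (inj) and the PINNED residue (c4a-T)**, (MM) discharged: `SndDualInjOnMoverKernels → PrintCarrierTwistConfinedExists C →
PrintSheafHandleExists C`. Both hypotheses stay hypotheses here ((inj) kernel-class, core-w3 g2's plate; (c4a-T) research).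
[cite: Markman2025SecantWeil, Thm. 1.4.1 and §9.3 Lemma 9.3.3] -/
theorem printSheafHandleExists_of_sndDualInj_of_printCarrierTwistConfinedExists (C : ChernCharacterBetti)
    (hinj : SndDualInjOnMoverKernels) (hT : PrintCarrierTwistConfinedExists C) : PrintSheafHandleExists C :=
  printSheafHandleExists_of_confined C moverFamilyOfConfined_holds hinj hT

end TwistConfinedMoverFamily

end Summit.HodgeConjecture.HodgeConjecture.Ring2.SemiregularRepresentatives

end
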